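import Summits.NavierStokesRegularity.NavierStokesRegularity.Theorems.TypeIQuarterGateQuarterLawTypeISparseCoreEngine
import HarnessLib

/-!
# `TypeIQuarterGate.QuarterLawTypeI` (crux stmt-NavierStokesRegularity-23726), line `lorentz-upgrade`,
# stub `stub_countQuarterLaw` (= item 23971 `CountQuarterLaw`) — REDUCTION TO ONE-SCALE SMALLNESS

Helper file (`--supports stmt-NavierStokesRegularity-23726`). With the sparse-core engine
(`CountQuarterLaw.quarterLaw_of_sparseCores`, file `TypeIQuarterGateQuarterLawTypeISparseCoreEngine`)
the registered stub

  `stub_countQuarterLaw : ∀ ν T, … IsTypeIBlowup u T → COUNT → ∃ K, ∀ t ∈ [0,T), ∫ ‖curl u(t)‖² ≤ K/√(T−t)`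

(COUNT = the scale-uniform ε-concentration count of `UniformConcentrationCountTypeI`, stmt-23970)
reduces to ONE analytic input, stated here INLINE as the hypothesis `hone` ("one-scale smallness"):

  for every `μ > 0` there are a threshold `η > 0`, a scale factor `λ > 0` and a time `t₀ < T` such
  that for `t ∈ (t₀, T)` and every `x` whose cylinder `Q_r(x, T)`, `r = λ√(T−t)`, is NOT
  `η`-concentrating (`¬ (η r ≤ ∫_{T−r²}^{T} ∫_{B_r(x)} |∇u|_F²)`), `‖u(t,x)‖ ≤ μ/√(T−t)`.

This is the one-scale ε-regularity (dissipation quantum, tree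
`EnstrophyQuarterLaw.DissipationQuantum.small_of_cknE_le`) at vertex-`T` cylinders under the Type-I
scaled bounds (tree `scaledEnergies_bounded_of_typeIRate_unif`), after unit-viscosity rescaling —
`λ` large makes `μ` small because the ε-regularity bound `l/(ϑ r)` improves with the scale. It is NOT
proved in this file.

* `countQuarterLaw_of_oneScale` — engine + COUNT + one-scale smallness ⇒ quarter law, for a
  classical Leray–Hopf rapidly-decaying-datum solution with the Type-I rate. The cores at time `t`
  are the doubled balls `B(xᵢ, 2r)` of a MAXIMAL `2r`-separated family of `η`-concentrating centres
  (`≤ N` members by COUNT, so volume `≤ 8 N λ³ |B₁| (T−t)^{3/2}`); off the cores a point is not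
  concentrating (else the family extends), so `hone` applies with `μ = √ν/4` (`16μ² = ν`).
* `stub_countQuarterLaw_of_oneScale` — the registered signature of `stub_countQuarterLaw` VERBATIM,
  from the one-scale smallness for every solution of the class.

HONEST FRAMING: bookkeeping along a HYPOTHETICAL Type-I blow-up; the stub is NOT closed (its
one-scale input is open in the tree, provable from printed ε-regularity); nothing about
Navier–Stokes regularity or blow-up is claimed. [folklore]
-/

-- the problem directory repeats the summit name (`NavierStokesRegularity/NavierStokesRegularity`)
set_option linter.dupNamespace false

noncomputable section

open Set Filter MeasureTheory Topology Metric
open scoped RealInnerProductSpace ENNReal NNReal ContDiff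

namespace Summit.NavierStokesRegularity.NavierStokesRegularity.Theorems

namespace CountQuarterLaw

open Literature.Analysis.FluidPDE EnvelopeQuarterLaw

/-- **COUNT + one-scale smallness ⇒ the quarter law** (Type-I, classical Leray–Hopf solution from a
rapidly decaying datum). The cores of the engine `quarterLaw_of_sparseCores` at time `t` are the
doubled balls of a maximal `2r`-separated family of `η`-concentrating centres at the single scale
`r = λ√(T−t)`; COUNT bounds their number by `N`, maximality makes every point off the cores
non-concentrating, and the one-scale smallness `hone` (at `μ = √ν/4`) bounds the velocity there.
[folklore] -/
theorem countQuarterLaw_of_oneScale (ν T : ℝ) (hν : 0 < ν) (hT : 0 < T)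
    (u : ℝ → EuclideanSpace ℝ (Fin 3) → EuclideanSpace ℝ (Fin 3))
    (p : ℝ → EuclideanSpace ℝ (Fin 3) → ℝ)
    (hsol : IsClassicalNSSolutionOn (Ico 0 T) ν 0 u p) (hLH : IsLerayHopfOn T ν 0 (u 0) u)
    (hdec : HasRapidSpatialDecay (u 0)) (hI : IsTypeIBlowup u T)
    (hone : ∀ μ : ℝ, 0 < μ → ∃ η lam t₀ : ℝ, 0 < η ∧ 0 < lam ∧ t₀ < T ∧
      ∀ t ∈ Ioo t₀ T, ∀ x : EuclideanSpace ℝ (Fin 3),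
        ¬ (ENNReal.ofReal (η * (lam * Real.sqrt (T - t))) ≤
            ∫⁻ s in Ioo (T - (lam * Real.sqrt (T - t)) ^ 2) T,
              ∫⁻ y in ball x (lam * Real.sqrt (T - t)),
                ENNReal.ofReal (frobeniusNormSq (fderiv ℝ (u s) y))) →
        ‖u t x‖ ≤ μ / Real.sqrt (T - t))
    (hcount : ∀ η : ℝ, 0 < η → ∃ N : ℕ, ∃ r₀ : ℝ, 0 < r₀ ∧ ∀ r : ℝ, 0 < r → r ≤ r₀ →
      ∀ σ : Finset (EuclideanSpace ℝ (Fin 3)),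
        (∀ x ∈ σ, ∀ x' ∈ σ, x ≠ x' → 2 * r ≤ ‖x - x'‖) →
        (∀ x ∈ σ, ENNReal.ofReal (η * r) ≤ ∫⁻ s in Ioo (T - r ^ 2) T, ∫⁻ y in ball x r,
          ENNReal.ofReal (frobeniusNormSq (fderiv ℝ (u s) y))) → σ.card ≤ N) :
    ∃ K : ℝ, ∀ t ∈ Ico 0 T,
      ∫⁻ x, ‖curl (u t) x‖ₑ ^ 2 ≤ ENNReal.ofReal (K / Real.sqrt (T - t)) := by
  classical
  -- the smallness level `μ = √ν/4`
  obtain ⟨μ, hμ_def⟩ : ∃ μ : ℝ, μ = Real.sqrt ν / 4 := ⟨_, rfl⟩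
  have hμ : 0 < μ := by rw [hμ_def]; exact div_pos (Real.sqrt_pos.2 hν) (by norm_num)
  have hμν : 16 * μ ^ 2 ≤ ν := by
    have e : (16 : ℝ) * (Real.sqrt ν / 4) ^ 2 = ν := by rw [div_pow, Real.sq_sqrt hν.le]; ring
    rw [hμ_def, e]
  obtain ⟨η, lam, t₀', hη, hlam, ht₀'T, hsmall⟩ := hone μ hμ
  obtain ⟨N, r₀, hr₀, hN⟩ := hcount η hη
  -- the unit-ball volume and the core volume constant
  obtain ⟨V₁, hV₁_def⟩ : ∃ V₁ : ℝ, V₁ = (volume (ball (0 : EuclideanSpace ℝ (Fin 3)) 1)).toReal :=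
    ⟨_, rfl⟩
  have hV₁ : 0 ≤ V₁ := by rw [hV₁_def]; exact ENNReal.toReal_nonneg
  obtain ⟨V, hV_def⟩ : ∃ V : ℝ, V = N * (8 * lam ^ 3 * V₁) := ⟨_, rfl⟩
  have hV : 0 ≤ V := by rw [hV_def]; positivity
  -- late times: `λ √(T−t) ≤ r₀`
  obtain ⟨t₀, ht₀_def⟩ : ∃ t₀ : ℝ, t₀ = max t₀' (T - (r₀ / lam) ^ 2) := ⟨_, rfl⟩
  have ht₀T : t₀ < T := by rw [ht₀_def]; exact max_lt ht₀'T (by have := div_pos hr₀ hlam; nlinarith)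
  refine quarterLaw_of_sparseCores ν T hν hT u p hsol hLH hdec hI ht₀T le_rfl hμ.le hμν hV ?_
  intro t ht
  have ht' : t ∈ Ioo t₀' T := ⟨lt_of_le_of_lt (ht₀_def ▸ le_max_left _ _) ht.1, ht.2⟩
  have hTt : 0 < T - t := by linarith [ht.2]
  -- the scale `r = λ √(T−t)`
  obtain ⟨s, hs_def⟩ : ∃ s : ℝ, s = Real.sqrt (T - t) := ⟨_, rfl⟩
  have hs : 0 < s := by rw [hs_def]; exact Real.sqrt_pos.2 hTt
  obtain ⟨r, hr_def⟩ : ∃ r : ℝ, r = lam * s := ⟨_, rfl⟩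
  have hr : 0 < r := by rw [hr_def]; positivity
  have hrr₀ : r ≤ r₀ := by
    have h1 : T - (r₀ / lam) ^ 2 < t := lt_of_le_of_lt (ht₀_def ▸ le_max_right _ _) ht.1
    have h2 : s ^ 2 < (r₀ / lam) ^ 2 := by rw [hs_def, Real.sq_sqrt hTt.le]; linarith
    have h3 : s < r₀ / lam := lt_of_pow_lt_pow_left₀ 2 (div_pos hr₀ hlam).le h2
    rw [hr_def]
    have := mul_lt_mul_of_pos_left h3 hlam
    rw [mul_div_cancel₀ _ hlam.ne'] at this
    exact this.le
  -- concentration and admissible families at scale `r`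
  set Conc : EuclideanSpace ℝ (Fin 3) → Prop := fun x =>
    ENNReal.ofReal (η * r) ≤ ∫⁻ s in Ioo (T - r ^ 2) T, ∫⁻ y in ball x r,
      ENNReal.ofReal (frobeniusNormSq (fderiv ℝ (u s) y)) with hConc
  set Adm : Finset (EuclideanSpace ℝ (Fin 3)) → Prop := fun σ =>
    (∀ x ∈ σ, ∀ x' ∈ σ, x ≠ x' → 2 * r ≤ ‖x - x'‖) ∧ ∀ x ∈ σ, Conc x with hAdm
  have hAdmN : ∀ σ, Adm σ → σ.card ≤ N := fun σ hσ => hN r hr hrr₀ σ hσ.1 hσ.2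
  set P : ℕ → Prop := fun k => ∃ σ, Adm σ ∧ σ.card = k with hP
  have hP0 : P 0 := ⟨∅, ⟨by simp, by simp⟩, rfl⟩
  obtain ⟨k, hk_def⟩ : ∃ k : ℕ, k = Nat.findGreatest P N := ⟨_, rfl⟩
  have hPk : P k := by rw [hk_def]; exact Nat.findGreatest_spec (Nat.zero_le N) hP0
  obtain ⟨σ, hσ, hσk⟩ := hPk
  -- the cores: doubled balls of the maximal family
  refine ⟨⋃ x ∈ σ, ball x (2 * r), Finset.measurableSet_biUnion σ fun _ _ => measurableSet_ball,
    ?_, ?_⟩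
  · -- volume
    refine (volume_cores_le σ (by positivity : (0 : ℝ) ≤ 2 * r)).trans (ENNReal.ofReal_le_ofReal ?_)
    rw [← hV₁_def, hV_def, hr_def, hs_def]
    have hcard : (σ.card : ℝ) ≤ N := by exact_mod_cast hAdmN σ hσ
    have : (2 * (lam * Real.sqrt (T - t))) ^ 3 * V₁ =
        8 * lam ^ 3 * V₁ * Real.sqrt (T - t) ^ 3 := by ring
    rw [this]
    have h0 : 0 ≤ 8 * lam ^ 3 * V₁ * Real.sqrt (T - t) ^ 3 := by positivity
    nlinarith
  · -- off the cores: not concentrating, by maximality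
    intro x hx
    have hnot : ¬ Conc x := by
      intro hcx
      -- `insert x σ` is admissible with `k + 1` members
      have hxσ : x ∉ σ := fun hmem =>
        hx (Set.mem_iUnion₂.2 ⟨x, hmem, mem_ball_self (by positivity)⟩)
      have hfar : ∀ x' ∈ σ, 2 * r ≤ ‖x - x'‖ := by
        intro x' hx'
        by_contra hlt
        push Not at hlt
        exact hx (Set.mem_iUnion₂.2 ⟨x', hx', mem_ball_iff_norm.2 hlt⟩)
      have hAdm' : Adm (insert x σ) := by
        refine ⟨?_, ?_⟩
        · intro a ha b hb hab
          rcases Finset.mem_insert.1 ha with rfl | ha'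
          · rcases Finset.mem_insert.1 hb with rfl | hb'
            · exact absurd rfl hab
            · exact hfar b hb'
          · rcases Finset.mem_insert.1 hb with rfl | hb'
            · rw [← norm_neg, neg_sub]; exact hfar a ha'
            · exact hσ.1 a ha' b hb' hab
        · intro a ha
          rcases Finset.mem_insert.1 ha with rfl | ha'
          · exact hcx
          · exact hσ.2 a ha'
      have hcard : (insert x σ).card = k + 1 := by rw [Finset.card_insert_of_notMem hxσ, hσk]
      have hk1N : k + 1 ≤ N := hcard ▸ hAdmN _ hAdm'
      have hle : k + 1 ≤ Nat.findGreatest P N := Nat.le_findGreatest hk1N ⟨_, hAdm', hcard⟩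
      rw [← hk_def] at hle
      omega
    have h := hsmall t ht' x (by rw [← hs_def, ← hr_def]; exact hnot)
    simpa using h

/-- **The registered stub `stub_countQuarterLaw` (signature VERBATIM) from one-scale smallness.**
If every classical Leray–Hopf rapidly-decaying-datum solution with the sup-norm Type-I rate at `T`
has the one-scale smallness property (non-`η`-concentrating cylinders `Q_{λ√(T−t)}(x, T)` force
`‖u(t,x)‖ ≤ μ/√(T−t)`, for every `μ > 0` with suitable `η, λ, t₀`), then COUNT ⇒ the quarter law,
i.e. the registered signature of `stub_countQuarterLaw` of the line `lorentz-upgrade`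
(= item `CountQuarterLaw`, stmt-23971). The stub itself is NOT closed here. [folklore] -/
theorem stub_countQuarterLaw_of_oneScale
    (hone : ∀ (ν T : ℝ), 0 < ν → 0 < T →
      ∀ (u : ℝ → EuclideanSpace ℝ (Fin 3) → EuclideanSpace ℝ (Fin 3))
        (p : ℝ → EuclideanSpace ℝ (Fin 3) → ℝ),
        IsClassicalNSSolutionOn (Ico 0 T) ν 0 u p → IsLerayHopfOn T ν 0 (u 0) u →
        HasRapidSpatialDecay (u 0) → IsTypeIBlowup u T →
        ∀ μ : ℝ, 0 < μ → ∃ η lam t₀ : ℝ, 0 < η ∧ 0 < lam ∧ t₀ < T ∧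
          ∀ t ∈ Ioo t₀ T, ∀ x : EuclideanSpace ℝ (Fin 3),
            ¬ (ENNReal.ofReal (η * (lam * Real.sqrt (T - t))) ≤
                ∫⁻ s in Ioo (T - (lam * Real.sqrt (T - t)) ^ 2) T,
                  ∫⁻ y in ball x (lam * Real.sqrt (T - t)),
                    ENNReal.ofReal (frobeniusNormSq (fderiv ℝ (u s) y))) →
            ‖u t x‖ ≤ μ / Real.sqrt (T - t)) :
    ∀ (ν T : ℝ), 0 < ν → 0 < T → ∀ (u : ℝ → EuclideanSpace ℝ (Fin 3) → EuclideanSpace ℝ (Fin 3))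
      (p : ℝ → EuclideanSpace ℝ (Fin 3) → ℝ),
      Literature.Analysis.FluidPDE.IsMaximalSmoothSolution ν 0 u p T →
      Literature.Analysis.FluidPDE.IsLerayHopfOn T ν 0 (u 0) u →
      Literature.Analysis.FluidPDE.HasRapidSpatialDecay (u 0) →
      Literature.Analysis.FluidPDE.IsTypeIBlowup u T →
      (∀ η : ℝ, 0 < η → ∃ N : ℕ, ∃ r₀ : ℝ, 0 < r₀ ∧ ∀ r : ℝ, 0 < r → r ≤ r₀ →
        ∀ σ : Finset (EuclideanSpace ℝ (Fin 3)),
          (∀ x ∈ σ, ∀ x' ∈ σ, x ≠ x' → 2 * r ≤ ‖x - x'‖) →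
          (∀ x ∈ σ, ENNReal.ofReal (η * r) ≤ ∫⁻ s in Set.Ioo (T - r ^ 2) T,
            ∫⁻ y in Metric.ball x r,
              ENNReal.ofReal (Literature.Analysis.FluidPDE.frobeniusNormSq (fderiv ℝ (u s) y))) →
          σ.card ≤ N) →
      ∃ K : ℝ, ∀ t ∈ Set.Ico 0 T,
        ∫⁻ x, ‖Literature.Analysis.FluidPDE.curl (u t) x‖ₑ ^ 2 ≤
          ENNReal.ofReal (K / Real.sqrt (T - t)) := by
  intro ν T hν hT u p hmax hLH hdec hI hcount
  exact countQuarterLaw_of_oneScale ν T hν hT u p hmax.1 hLH hdec hI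
    (hone ν T hν hT u p hmax.1 hLH hdec hI) hcount

end CountQuarterLaw

end Summit.NavierStokesRegularity.NavierStokesRegularity.Theorems

end
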